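import Mathlib
import HarnessLib
import Summits.NavierStokesRegularity.FluidComputer.TriggeredTransfer

/-!
# Zoom calculus for the cascade gluing: derivatives under the space–time affine maps
# `(t, x) ↦ (t₀ + β t, x₀ + γ x)`, force exchange and pressure normalisation

Cell `ns-blowup`, seat `ns-blowup-fc-prover-1` (D-0074 GROUP C «bridge support», door N1-FC); third
file of the cascade-gluing argument over `TriggeredTransfer.lean`. LABEL: E–C bookkeeping (analysis,
no fluid content beyond the structure `IsClassicalNSSolutionOn`). WHAT THIS IS NOT: not Navier–Stokes
evidence — elementary lemmas used to move the TRIGGERS of a linked run to their physical scale: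

* `norm_iteratedFDeriv_smul_comp_affine_le`: `‖Dⁿ(c • f (L · + v))(x)‖ ≤ |c| ‖L‖ⁿ ‖Dⁿ f (L x + v)‖`
  for a continuous linear `L` (Mathlib `ContinuousLinearMap.iteratedFDeriv_comp_right`,
  `ContinuousMultilinearMap.norm_compContinuousLinearMap_le`); specialised to the space–time
  pull-back `stPull β γ t₀ x₀` of `SpaceTimeRescaling` (`norm_iteratedFDeriv_smul_stPull_le`, operator
  norm `≤ max |β| |γ|`) — the `C^m` size of a zoomed trigger;
* a classical solution stays one when the force is replaced by an equal one on the time set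
  (`IsClassicalNSSolutionOn.force_congr`) or the pressure is normalised by its value at the origin
  (`IsClassicalNSSolutionOn.normalise_pressure`), and `(r ↦ t₀ + β r)⁻¹' [a, b] = [(a-t₀)/β, (b-t₀)/β]`.

The SPATIAL zoom of data `x ↦ c • w (c • (x - x₀))` (Clay clauses, energy) is the companion file
`TriggeredTransferDataZoom.lean` (seat `ns-blowup-fc-prover-2`); the zero force is a Clay force by
`Theorems.isSmoothOnHalfSpace_zero` / `Theorems.hasRapidSpaceTimeDecay_zero` (`SoloInformedClayDichotomy`).

References: J. Leray, Acta Math. 63 (1934) §20 (similarity); C. L. Fefferman, Clay problem (C).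
0 sorry; axioms ⊆ {propext, Classical.choice, Quot.sound}.
-/

noncomputable section

namespace Summit.NavierStokesRegularity.FluidComputer.TriggeredTransfer

open Set Filter Function MeasureTheory
open scoped Topology ENNReal ContDiff
open Literature.Analysis.FluidPDE
open Literature.Analysis.FluidPDE.FluidComputer (E3 Vel)

/-! ## Iterated derivatives under affine reparametrisation -/

section Affine

variable {E F G : Type*} [NormedAddCommGroup E] [NormedSpace ℝ E] [NormedAddCommGroup F]
  [NormedSpace ℝ F] [NormedAddCommGroup G] [NormedSpace ℝ G]

/-- **Chain rule bound under an affine map**: for `f ∈ Cⁿ`, a continuous linear map `L` and a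
vector `v`, `‖Dⁿ (f (L · + v)) (x)‖ ≤ ‖L‖ⁿ ‖Dⁿ f (L x + v)‖` (the `n`-th derivative of `f ∘ (L + v)`
is `Dⁿ f` composed with `L` in each slot). [folklore] -/
theorem norm_iteratedFDeriv_comp_affine_le {f : F → G} {n : ℕ} (hf : ContDiff ℝ n f)
    (L : E →L[ℝ] F) (v : F) (x : E) :
    ‖iteratedFDeriv ℝ n (fun y => f (L y + v)) x‖ ≤ ‖L‖ ^ n * ‖iteratedFDeriv ℝ n f (L x + v)‖ := by
  have hfv : ContDiff ℝ n (fun z => f (z + v)) := hf.comp (contDiff_id.add contDiff_const)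
  have h1 : (fun y => f (L y + v)) = (fun z => f (z + v)) ∘ L := rfl
  rw [h1, L.iteratedFDeriv_comp_right hfv x le_rfl, iteratedFDeriv_comp_add_right]
  calc ‖(iteratedFDeriv ℝ n f (L x + v)).compContinuousLinearMap fun _ => L‖
      ≤ ‖iteratedFDeriv ℝ n f (L x + v)‖ * ∏ _i : Fin n, ‖L‖ :=
        ContinuousMultilinearMap.norm_compContinuousLinearMap_le _ _
    _ = ‖L‖ ^ n * ‖iteratedFDeriv ℝ n f (L x + v)‖ := by rw [Fin.prod_const, mul_comm]

/-- **Chain rule bound under an affine map, with an amplitude**: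
`‖Dⁿ (c • f (L · + v)) (x)‖ ≤ |c| ‖L‖ⁿ ‖Dⁿ f (L x + v)‖`. [folklore] -/
theorem norm_iteratedFDeriv_smul_comp_affine_le {f : F → G} {n : ℕ} (hf : ContDiff ℝ n f) (c : ℝ)
    (L : E →L[ℝ] F) (v : F) (x : E) :
    ‖iteratedFDeriv ℝ n (fun y => c • f (L y + v)) x‖ ≤
      |c| * ‖L‖ ^ n * ‖iteratedFDeriv ℝ n f (L x + v)‖ := by
  have hcomp : ContDiff ℝ n (fun y => f (L y + v)) :=
    hf.comp ((L.contDiff).add contDiff_const)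
  rw [iteratedFDeriv_const_smul_apply' hcomp.contDiffAt, norm_smul, Real.norm_eq_abs, mul_assoc]
  exact mul_le_mul_of_nonneg_left (norm_iteratedFDeriv_comp_affine_le hf L v x) (abs_nonneg c)

end Affine

/-! ## The space–time pull-back `stPull β γ t₀ x₀` -/

section Pull

variable {F : Type*} [NormedAddCommGroup F] [NormedSpace ℝ F]

/-- The linear part `(s, y) ↦ (β s, γ y)` of the space–time map `(s, y) ↦ (t₀ + β s, x₀ + γ y)`. [folklore] -/
def zoomLinear (β γ : ℝ) : ℝ × E3 →L[ℝ] ℝ × E3 :=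
  (β • ContinuousLinearMap.fst ℝ ℝ E3).prod (γ • ContinuousLinearMap.snd ℝ ℝ E3)

/-- Unfolding `zoomLinear`. [folklore] -/
@[simp] theorem zoomLinear_apply (β γ : ℝ) (z : ℝ × E3) :
    zoomLinear β γ z = (β * z.1, γ • z.2) := rfl

/-- Operator norm of the linear part: `‖(s, y) ↦ (β s, γ y)‖ ≤ max |β| |γ|` (sup norm on the
product). [folklore] -/
theorem norm_zoomLinear_le (β γ : ℝ) : ‖zoomLinear β γ‖ ≤ max |β| |γ| := by
  refine ContinuousLinearMap.opNorm_le_bound _ (le_max_of_le_left (abs_nonneg β)) fun z => ?_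
  rw [zoomLinear_apply, Prod.norm_def, Prod.norm_def]
  refine max_le ?_ ?_
  · calc ‖β * z.1‖ = |β| * ‖z.1‖ := by rw [norm_mul, Real.norm_eq_abs]
      _ ≤ max |β| |γ| * max ‖z.1‖ ‖z.2‖ :=
          mul_le_mul (le_max_left _ _) (le_max_left _ _) (norm_nonneg _)
            (le_max_of_le_left (abs_nonneg β))
  · calc ‖γ • z.2‖ = |γ| * ‖z.2‖ := by rw [norm_smul, Real.norm_eq_abs]
      _ ≤ max |β| |γ| * max ‖z.1‖ ‖z.2‖ :=
          mul_le_mul (le_max_right _ _) (le_max_right _ _) (norm_nonneg _)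
            (le_max_of_le_left (abs_nonneg β))

/-- The uncurried amplitude-times-pull-back is the amplitude times the uncurried field composed
with the affine space–time map. [folklore] -/
theorem uncurry_smul_stPull (c β γ t₀ : ℝ) (x₀ : E3) (ψ : ℝ → E3 → F) :
    uncurry (c • stPull β γ t₀ x₀ ψ) = fun z => c • uncurry ψ (zoomLinear β γ z + (t₀, x₀)) := by
  funext z
  obtain ⟨s, y⟩ := z
  simp only [uncurry_apply_pair, Pi.smul_apply, stPull_apply, zoomLinear_apply, Prod.mk_add_mk]
  rw [add_comm (β * s), add_comm (γ • y)]

/-- The amplitude-times-pull-back of a `Cⁿ` space–time field is `Cⁿ`. [folklore] -/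
theorem contDiff_uncurry_smul_stPull {ψ : ℝ → E3 → F} {n : WithTop ℕ∞}
    (hψ : ContDiff ℝ n (uncurry ψ)) (c β γ t₀ : ℝ) (x₀ : E3) :
    ContDiff ℝ n (uncurry (c • stPull β γ t₀ x₀ ψ)) := by
  rw [uncurry_smul_stPull]
  exact (hψ.comp ((zoomLinear β γ).contDiff.add contDiff_const)).const_smul c

/-- **`C^m` size of a zoomed field**: for a `C^m` space–time field `ψ` and `β, γ ≥ 0`,
`‖D^m (c • stPull β γ t₀ x₀ ψ) (s, y)‖ ≤ |c| (max β γ)^m ‖D^m ψ (t₀ + β s, x₀ + γ y)‖`. [folklore] -/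
theorem norm_iteratedFDeriv_smul_stPull_le {ψ : ℝ → E3 → F} {m : ℕ}
    (hψ : ContDiff ℝ m (uncurry ψ)) (c : ℝ) {β γ : ℝ} (hβ : 0 ≤ β) (hγ : 0 ≤ γ) (t₀ : ℝ) (x₀ : E3)
    (z : ℝ × E3) :
    ‖iteratedFDeriv ℝ m (uncurry (c • stPull β γ t₀ x₀ ψ)) z‖ ≤
      |c| * (max β γ) ^ m * ‖iteratedFDeriv ℝ m (uncurry ψ) (t₀ + β * z.1, x₀ + γ • z.2)‖ := by
  rw [uncurry_smul_stPull]
  have hpt : zoomLinear β γ z + (t₀, x₀) = (t₀ + β * z.1, x₀ + γ • z.2) := by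
    rw [zoomLinear_apply, Prod.mk_add_mk, add_comm (β * z.1), add_comm (γ • z.2)]
  refine (norm_iteratedFDeriv_smul_comp_affine_le hψ c (zoomLinear β γ) (t₀, x₀) z).trans ?_
  rw [hpt]
  refine mul_le_mul_of_nonneg_right ?_ (norm_nonneg _)
  refine mul_le_mul_of_nonneg_left ?_ (abs_nonneg c)
  refine pow_le_pow_left₀ (norm_nonneg _) ((norm_zoomLinear_le β γ).trans (le_of_eq ?_)) m
  rw [abs_of_nonneg hβ, abs_of_nonneg hγ]

end Pull

/-! ## Force exchange; pressure normalisation; affine preimages -/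

section Classical

variable {E : Type*} [NormedAddCommGroup E] [InnerProductSpace ℝ E] [FiniteDimensional ℝ E]
  {F : Type*} [NormedAddCommGroup F] [NormedSpace ℝ F]

variable {S : Set ℝ} {ν : ℝ} {f g u : ℝ → E → E} {p : ℝ → E → ℝ}

/-- **Force exchange**: a classical solution for the force `f` on the time set `S` is a classical
solution for any force `g` that agrees with `f` at every time of `S` (the equation is pointwise in
`t ∈ S`). [folklore] -/
theorem _root_.Literature.Analysis.FluidPDE.IsClassicalNSSolutionOn.force_congr
    (h : IsClassicalNSSolutionOn S ν f u p) (hfg : ∀ t ∈ S, f t = g t) :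
    IsClassicalNSSolutionOn S ν g u p where
  smooth_velocity := h.smooth_velocity
  smooth_pressure := h.smooth_pressure
  momentum t ht x := by rw [← hfg t ht]; exact h.momentum t ht x
  divFree := h.divFree

/-- **Pressure normalisation**: subtracting from the pressure its value at the spatial origin
(a function of time alone) gives again a classical solution (`∇(p - p(·,0)) = ∇p`). [folklore] -/
theorem _root_.Literature.Analysis.FluidPDE.IsClassicalNSSolutionOn.normalise_pressure
    (h : IsClassicalNSSolutionOn S ν f u p) :
    IsClassicalNSSolutionOn S ν f u (fun t x => p t x - p t 0) where
  smooth_velocity := h.smooth_velocity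
  smooth_pressure := h.smooth_pressure.sub_apply_zero
  momentum t ht x := by rw [gradient_sub_const]; exact h.momentum t ht x
  divFree := h.divFree

omit [NormedAddCommGroup E] [InnerProductSpace ℝ E] [FiniteDimensional ℝ E] in
/-- Preimage of a closed interval under an increasing affine time change:
`(r ↦ t₀ + β r)⁻¹' [a, b] = [(a - t₀)/β, (b - t₀)/β]` (`β > 0`). [folklore] -/
theorem preimage_affine_Icc {β : ℝ} (hβ : 0 < β) (t₀ a b : ℝ) :
    (fun r => t₀ + β * r) ⁻¹' Icc a b = Icc ((a - t₀) / β) ((b - t₀) / β) := by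
  ext r
  simp only [mem_preimage, mem_Icc]
  rw [div_le_iff₀ hβ, le_div_iff₀ hβ]
  constructor <;> rintro ⟨h1, h2⟩ <;> constructor <;> linarith

end Classical

end Summit.NavierStokesRegularity.FluidComputer.TriggeredTransfer

end
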